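import Summits.AtomisticToContinuum.HydrodynamicLimit.Theses.OneFlightGossipEngine
import Literature.Analysis.FluidPDE.LocalForecastCorrector

/-!
# Sketch — crux `KineticCurrentsWindowLDUniform` (stmt-AtomisticToContinuum-14662),
crux-ideate round 1, ideator 1: first-lemma signatures of two levers

* § A `sigma-uniform-equilibrium-transfer` — the local-Gibbs → equilibrium transfer at
  EXPONENTIAL scale: `WindowQuasiInvariance` (Rényi quasi-invariance of the local Gibbs law over a
  kinetic window), `LocalWindowInfluenceLocality` (the local-Gibbs twin of AntiMazur's typed
  `InfluenceLocality` 13916), the σ-LOCALLY-UNIFORM equilibrium antecedent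
  `EqCurrentsWindowLDSigmaU` for the crux's own class, and the composition target
  `TransferTarget : … → KineticCurrentsWindowLDUniform`.
* § B `gossip-forecast-ledger` — the two closed-form facts the sparse kick ledger consumes for
  THIS class: `StressDriftGain` (second-order orthogonality is EXACT for the traceless stress:
  the drift-tilt gain is `A:(δ⊗δ)`, no higher orders) and `OneKickForecast` (termwise gossip:
  an isotropic mean-zero kick leaves the traceless form of the host velocity unchanged in
  conditional mean).

Everything is a `def … : Prop` (statements, not proofs) or a plain definition; the file must only
ELABORATE (crux-ideate stage: no skeleton, no stubs).
-/

noncomputable section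

namespace Summit.AtomisticToContinuum.HydrodynamicLimit.Cruxes.KineticCurrentsWindowLDUniform.IdeatorOne

open MeasureTheory Filter Topology
open scoped ENNReal Classical
open Literature.Analysis.FluidPDE Literature.MathematicalPhysics.KineticTheory
open Summit.AtomisticToContinuum.HydrodynamicLimit.Theses.OneFlightGossipEngine
  (KineticCurrentsWindowLDUniform)

/-! ## § 0 Frame -/

/-- The hard-sphere flows of the crux: `N + 1` spheres of diameter `σ (N+1)^{-1/3}` on `𝕋³`. -/
abbrev Flow (σ : ℝ) (N : ℕ) : Type :=
  HardSphereFlow (Torus.geometry (Fin 3)) (hsDiameter σ N) (N + 1)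

/-- Phase space of `N + 1` spheres on `𝕋³`. -/
abbrev Phase (N : ℕ) : Type := Config (N + 1) (Fin 3) T3

/-- The kinetic window `w_N = τ (N+1)^{-1/3}` (macroscopic units). -/
def window (τ : ℝ) (N : ℕ) : ℝ := τ * ((N : ℝ) + 1) ^ (-(1 / 3 : ℝ))

/-- The microscopic length `ℓ_N = (N+1)^{-1/3}`. -/
def scale (N : ℕ) : ℝ := ((N + 1 : ℕ) : ℝ) ^ (-(1 / 3 : ℝ))

/-- The crux's class of fast kinetic currents `F(x,v) = A(x):(w⊗w) + (b(x)·w) G(x,|w|²)`,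
`w = v − u₀(x)` (verbatim the integrand of `KineticCurrentsWindowLDUniform`). -/
def current (u₀ : T3 → V3) (A : T3 → Fin 3 → Fin 3 → ℝ) (b : T3 → V3) (G : T3 × ℝ → ℝ)
    (y : T3 × V3) : ℝ :=
  (∑ j : Fin 3, ∑ k : Fin 3, A y.1 j k * ((y.2 - u₀ y.1) j * (y.2 - u₀ y.1) k))
    + (∑ j : Fin 3, b y.1 j * (y.2 - u₀ y.1) j) * G (y.1, ‖y.2 - u₀ y.1‖ ^ 2)

/-- Admissibility of `(A, b, G)` at profiles `(u₀, θ₀)`: continuity, quadratic growth, and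
orthogonality to `1, v_j, |v|²` under the local Maxwellian at every `x` (the crux's hypotheses). -/
def Admissible (u₀ : T3 → V3) (θ₀ : T3 → ℝ) (A : T3 → Fin 3 → Fin 3 → ℝ) (b : T3 → V3)
    (G : T3 × ℝ → ℝ) : Prop :=
  Continuous A ∧ Continuous b ∧ Continuous G ∧
  (∃ C : ℝ, ∀ y : T3 × V3, |current u₀ A b G y| ≤ C * (1 + ‖y.2‖ ^ 2)) ∧
  (∀ x, ∫ v, current u₀ A b G (x, v) * localMaxwellian 1 (θ₀ x) (u₀ x) v = 0) ∧
  (∀ x (j : Fin 3), ∫ v, current u₀ A b G (x, v) * v j * localMaxwellian 1 (θ₀ x) (u₀ x) v = 0) ∧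
  (∀ x, ∫ v, current u₀ A b G (x, v) * ‖v‖ ^ 2 * localMaxwellian 1 (θ₀ x) (u₀ x) v = 0)

/-- The window functional `Σ_i w⁻¹ ∫₀^w F(z_i(r)) dr` along the flow. -/
def windowSum {σ : ℝ} {N : ℕ} (Φ : Flow σ N) (w : ℝ) (F : T3 × V3 → ℝ) (z : Phase N) : ℝ :=
  ∑ i : Fin (N + 1), w⁻¹ * ∫ r in (0 : ℝ)..w, F ((Φ.flow r z) i)

/-- The LD bound shape of the crux: `∫ exp(β · windowSum) dμ ≤ exp(ε (N+1))`. -/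
def LdBound {σ : ℝ} {N : ℕ} (Φ : Flow σ N) (μ : Measure (Phase N)) (β w ε : ℝ)
    (F : T3 × V3 → ℝ) : Prop :=
  ∫⁻ z, ENNReal.ofReal (Real.exp (β * windowSum Φ w F z)) ∂μ
    ≤ ENNReal.ofReal (Real.exp (ε * ((N : ℝ) + 1)))

/-! ## § A  Lever `sigma-uniform-equilibrium-transfer` -/

/-- Logarithm of the UNNORMALISED local Gibbs density `Π_i a(x_i) M_{1,u₀(x_i),θ₀(x_i)}(v_i)`
(the hard-core indicator and the partition function are flow-invariant and cancel in ratios). -/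
def lgLogDensity {N : ℕ} (a θ₀ : T3 → ℝ) (u₀ : T3 → V3) (z : Phase N) : ℝ :=
  ∑ i : Fin (N + 1), Real.log (localGibbsProfile a u₀ θ₀ (z i))

/-- **First lemma of lever A — WINDOW QUASI-INVARIANCE OF THE LOCAL GIBBS LAW AT EXPONENTIAL
(RÉNYI) SCALE.** For continuous positive profiles, every `σ > 0`, some `γ₀ > 0` (depending on
`θ_max/θ_min` only) and every kinetic window `τ`: the `λ_loc`-exponential moment of
`γ · [log ρ(Φ_t z) − log ρ(z)]`, `|γ| ≤ γ₀`, `|t| ≤ w_N = τ(N+1)^{-1/3}`, is `e^{o(N)}`. Since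
`d(Φ_s # λ_loc)/dλ_loc = ρ∘Φ_{-s}/ρ` on the (invariant) hard-sphere domain by Liouville, this says
all Rényi divergences of order `1 ± γ₀` between `λ_loc` and its push-forwards over a kinetic window
are `o(N)`, so Hölder moves exponential moments across the window for free. Free gas: dominated
convergence (the exponent is `≤ |v|²·osc(1/2θ₀)`, quadratic, and `→ 0` pointwise as `w_N → 0`).
Hard spheres: plus "no LD-cheap energy courier across the temperature gradient within a kinetic
window" (energy moves at carrier speed `+ ε` per collision; fast carriers are priced by the
Maxwellian tail at time `0`). -/
def WindowQuasiInvariance : Prop :=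
  ∀ (a θ₀ : T3 → ℝ) (u₀ : T3 → V3), Continuous a → Continuous θ₀ → Continuous u₀ →
    (∀ x, 0 < a x) → (∀ x, 0 < θ₀ x) → ∀ σ : ℝ, 0 < σ → ∃ γ₀ : ℝ, 0 < γ₀ ∧
    ∀ γ : ℝ, |γ| ≤ γ₀ → ∀ τ : ℝ, 0 < τ → ∀ ε : ℝ, 0 < ε → ∃ N₀ : ℕ, ∀ N : ℕ, N₀ ≤ N →
    ∀ (Φ : Flow σ N) (t : ℝ), |t| ≤ window τ N →
      ∫⁻ z, ENNReal.ofReal (Real.exp (γ * (lgLogDensity a θ₀ u₀ (Φ.flow t z)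
          - lgLogDensity a θ₀ u₀ z))) ∂(localGibbsLaw σ a u₀ θ₀ N Φ)
        ≤ ENNReal.ofReal (Real.exp (ε * ((N : ℝ) + 1)))

/-- **LOCAL-GIBBS WINDOW INFLUENCE LOCALITY (LD form)** — the twin of AntiMazurCoboundaries'
typed `InfluenceLocality` (stmt-13916) with the global Gibbs law replaced by the local one:
particle `i` is BAD if at some `t ∈ [0, T ℓ_N]` its true state differs from its local forecast
`localClusterState Ψ (R ℓ_N) t z i` (only the particles initially within `R ℓ_N` evolved);
`∀ T, lam, δ ∃ R, N₀ : ∫ exp(lam · #bad) dλ_loc ≤ e^{δ(N+1)}`. (13916's intended proof uses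
"Maxwellian at every time", i.e. invariance; here that step is supplied by
`WindowQuasiInvariance`.) -/
def LocalWindowInfluenceLocality : Prop :=
  ∀ (a θ₀ : T3 → ℝ) (u₀ : T3 → V3), Continuous a → Continuous θ₀ → Continuous u₀ →
    (∀ x, 0 < a x) → (∀ x, 0 < θ₀ x) → ∀ σ : ℝ, 0 < σ →
    ∀ (T lam δ : ℝ), 0 < T → 0 < lam → 0 < δ → ∃ R : ℝ, 0 < R ∧ ∃ N₀ : ℕ, ∀ N : ℕ, N₀ ≤ N →
    ∀ (Φ : Flow σ N) (Ψ : (k : ℕ) → HardSphereFlow (Torus.geometry (Fin 3)) (hsDiameter σ N) k),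
      ∫⁻ z, ENNReal.ofReal (Real.exp (lam *
        ((Finset.univ.filter fun i : Fin (N + 1) =>
          ∃ t ∈ Set.Icc (0 : ℝ) (T * scale N),
            Φ.flow t z i ≠ localClusterState Ψ (R * scale N) t z i).card : ℝ)))
        ∂(localGibbsLaw σ a u₀ θ₀ N Φ)
      ≤ ENNReal.ofReal (Real.exp (δ * ((N : ℝ) + 1)))

/-- **The transfer's dynamical antecedent `C⁺`: EQUILIBRIUM window LD for the crux's class,
LOCALLY UNIFORM IN THE REDUCED DENSITY.** Global Gibbs data with constant activity (which cancels
in the canonical law: `a ≡ 1`), zero drift (Galilean boost) and constant temperature `θ₀`; the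
class is the crux's with constant profiles `u₀ ≡ 0`, `θ₀`; the constants `β₀, τ, N₀` are
UNIFORM for `σ` in any compact `[σ₁, σ₂] ⊂ (0, σ₀)` — exactly what block reduced densities
`σ_eff³ = σ³ a(x)/∫a ∈ [σ³ a_min/∫a, η₀]` require, and what a pointwise-in-`σ` antecedent
(TwoClocks' `EquilibriumFastWindowLD` 14440 → 14443) does not provide. -/
def EqCurrentsWindowLDSigmaU : Prop :=
  ∃ σ₀ : ℝ, 0 < σ₀ ∧ ∀ σ₁ σ₂ : ℝ, 0 < σ₁ → σ₁ ≤ σ₂ → σ₂ < σ₀ → ∀ θ₀ : ℝ, 0 < θ₀ →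
    ∀ (A : T3 → Fin 3 → Fin 3 → ℝ) (b : T3 → V3) (G : T3 × ℝ → ℝ),
      Admissible (fun _ => 0) (fun _ => θ₀) A b G →
      ∃ β₀ : ℝ, 0 < β₀ ∧ ∀ β : ℝ, |β| ≤ β₀ → ∀ ε : ℝ, 0 < ε → ∃ τ : ℝ, 0 < τ ∧ ∃ N₀ : ℕ,
        ∀ σ : ℝ, σ₁ ≤ σ → σ ≤ σ₂ → ∀ N : ℕ, N₀ ≤ N → ∀ Φ : Flow σ N,
          LdBound Φ (localGibbsLaw σ (fun _ => 1) (fun _ => 0) (fun _ => θ₀) N Φ) β (window τ N) ε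
            (current (fun _ => 0) A b G)

/-- **Composition target of lever A** (the future skeleton's `KineticCurrentsWindowLDUniform_of`,
stated; the remaining inputs — static freezing at a mesoscopic scale `L_f` (Rényi cost
`O(N ω(L_f)) = o(N)`, `ω` the profiles' modulus of continuity, Gaussian MGF), chessboard Hölder
over 27 colours (amplitude `27β`), DLR
corridor decoupling + ensemble equivalence at cost `e^{o(N)}`, Galilean boost and thermal
time-rescaling per block, convexity of log-moment functionals in `F` for uniformity over the
compact family of frozen coefficients — are provable-grade and ride as supports). -/
def TransferTarget : Prop :=
  WindowQuasiInvariance → LocalWindowInfluenceLocality → EqCurrentsWindowLDSigmaU →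
    KineticCurrentsWindowLDUniform

/-! ## § B  Lever `gossip-forecast-ledger` -/

/-- **First lemma of lever B — SECOND-ORDER ORTHOGONALITY IS EXACT FOR THE TRACELESS STRESS.**
For a traceless `A`, the drifted local Maxwellian gains exactly the quadratic form of the drift:
`∫ A:((v−u)⊗(v−u)) M_{1,θ,u+δ}(v) dv = A:(δ⊗δ)` (no first order — orthogonality to `v_j` —, no
orders above two, and temperature tilts gain `0`). Consequence for the Csiszár/LE projection step
of the ledger: the local-equilibrium part of ANY tilt pays `|δ|²/(2θ)` per particle and gains at
most `β‖A‖_op |δ|²`, so it leaves the problem for `|β| < 1/(2θ‖A‖_op)` — the ORIGIN of the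
crux's `∃ β₀` for the stress half of the class (for the odd half the first order vanishes by the
radial orthogonality `∫ w₁² G(|w|²) M = 0` and the gain is `O(|δ|²)` with the growth constant).
[provable now, S–M: expand `(v−u) = (v−u−δ) + δ`, Gaussian moments of `localMaxwellian`.] -/
def StressDriftGain : Prop :=
  ∀ (A : Fin 3 → Fin 3 → ℝ), (∑ j : Fin 3, A j j = 0) → ∀ θ : ℝ, 0 < θ → ∀ u δ : V3,
    ∫ v, (∑ j : Fin 3, ∑ k : Fin 3, A j k * ((v - u) j * (v - u) k)) * localMaxwellian 1 θ (u + δ) v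
      = ∑ j : Fin 3, ∑ k : Fin 3, A j k * (δ j * δ k)

/-- **ONE-KICK FORECAST (termwise gossip).** A kick `V ↦ V + h ω` with `ω` mean-zero, carried by
the unit sphere and with isotropic second moments leaves the traceless quadratic form of the host
velocity unchanged IN MEAN, whatever `h` (the pair's half relative speed): `E_ω A:((V+hω)⊗(V+hω))
= A:(V⊗V)` for traceless `A`. Iterated along a schedule with fair kicks this is the route's
`GossipStressIdentity` (9533) particle by particle: the equilibrium FORECAST of a particle's future
traceless stress given the schedule is the traceless form of its gossip-averaged velocity — the
closed-form forecast the ledger needs (`osc_k` = its change under one kick). [provable now, S] -/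
def OneKickForecast : Prop :=
  ∀ ν : Measure V3, IsProbabilityMeasure ν → (∀ᵐ ω ∂ν, ‖ω‖ = 1) → (∫ ω, ω ∂ν = 0) →
    (∀ e : V3, ∫ ω, (inner ℝ ω e) ^ 2 ∂ν = ‖e‖ ^ 2 / 3) →
    ∀ (A : Fin 3 → Fin 3 → ℝ), (∑ j : Fin 3, A j j = 0) → ∀ (V : V3) (h : ℝ),
      ∫ ω, (∑ j : Fin 3, ∑ k : Fin 3, A j k * ((V + h • ω) j * (V + h • ω) k)) ∂ν
        = ∑ j : Fin 3, ∑ k : Fin 3, A j k * (V j * V k)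

end Summit.AtomisticToContinuum.HydrodynamicLimit.Cruxes.KineticCurrentsWindowLDUniform.IdeatorOne
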